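import Literature.Probability.Percolation.KozmaNitzanSteps
import Summits.CriticalPhenomena.PercolationContinuityZ3.Theorems.FK.Transplant.FreeBoundaryHypotheses
import Summits.CriticalPhenomena.PercolationContinuityZ3.Theorems.FK.Transplant.KNFreePinningLaw
import HarnessLib

/-!
# FK-continuity transplant, FT-06 (part 1, the setting of one examination): the events `B_j`, the geometric twin,
# "bad is decreasing", the almost sure bookkeeping and Step IV's first claim under the minimal law `P^x`

Cell `fk-continuity` (bschramm), FRONTIER TRANSPLANT sub-cell, registry row FT-06 (`KNFreeSteps`, part 1 `KNFreeStepsSetting`),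
BINDER-OWNERS row 7 (h_bad); support file (`--supports stmt-CriticalPhenomena-4575`); builds on p205010 (kernel theorem, internal
audit signed; external expert review pending). HONEST FRAMING: the transplant `ufsc0_of_freeBoundaryHypothesis_r0`
this file serves is CONDITIONAL on the free-boundary penetration hypothesis FH (open at the same `p` for `q > 1`;
⇔ GRC Conj. (5.103) via the referee's calibration K1: "[C3a ∀ p > p_c(q)] ∧ C3b ⇒ p̂_c(q) = p_c(q) = GRC Conj (5.103)
= DT Question 5 (open for q ∈ (1,2))"; barrier note `Literature.Barriers.CriticalPhenomena.SamePFreeBoundaryCriteria`,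
p243859); it is a typed reduction, not a proof of FK continuity. THIS file is unconditional: no named facts, no
sorries, standard axioms; `FH` does not occur in it.

## What is here

Kozma–Nitzan, arXiv:2401.12397 §4, Theorem 6 Steps II–IV (pp. 28–31) for ONE onward direction `x = v + du` after
a valid history, with the product law replaced by the transplant's per-direction MINIMAL law
`P^x = fkLaw (S.Sx h e du) (S.Wfull h e du) q` (REFUTER-REPORT §8 F4; FT-01 `FreeBoundaryHypotheses.lean`: `fkLaw`,
`condFK`, `badFK`, `ValidFK`, `FKCorridorAt`, `FKTargetAt`). Everything is proved for the law functor
`W ↦ fkLaw (S.Sx h e du) W q` ASSUMED to be a pinning law on a domain `D ⊇ pairsF (Sx h e du)`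
(`Transplant.IsPinningLaw`, FT-06b `KNFreePinningLaw.lean`: conditioning on a finite pattern = KN pinning,
weight-monotone on increasing events, support and 0/1-weights a.s.); the instance `isPinningLaw_fkLaw` (FT-06d, on
FT-05's `rcMeasureW` conditioning API) then discharges the binder `KNFreeBadBound` in `KNFreeBad.lean`.
The GEOMETRY is Kozma–Nitzan's, imported verbatim from `Literature/Probability/Percolation/KozmaNitzanSteps.lean`
through the geometric twin `(geomTwin S) = ⟨S.C, S.p, 2⟩` (KN's scheme with the vacuous threshold `δ = 2`, whose
`KSch.Valid` is exactly the geometric part of `ValidFK`): `exists_face_prefix`, `reach_subset_Aface`,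
`Aface_subset_Aface`, `mem_Aface_of_reach`, `isTarget_stepIII`, `Valid.cd_hyp`, `Valid.cd_Aset`, `pinW_Wfull_eq_Wt`.

* `condFK_mono`, `isLowerSet_badFK` — goodness (30)-FK is monotone in the observed pattern, so **"bad for
  `x`" is a DECREASING event** (F4 (b); weight monotonicity (M), `q ≥ 1` inside the instance).
* `reach_boundFK` — **Step IV, first claim** (pp. 30–31): (32)-FK under the law of `W₀` on `Sx` and the FK
  corridor inequality `FKCorridorAt` (Lemma 12) give `P^x(0 ↔ M_x in E_i ∪ E_{w,v} ∪ H_{v,x}) > 1 - ε'`; the passage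
  `W₀ → Wfull` (an equality at `q = 1`, product structure) is the monotonicity (M) on an increasing event.
* Step III and the chain (36)–(37) (`condFK_of_face`, `real_badFK_le_of_isPinningLaw`) are part 2, `KNFreeSteps.lean`.

## References

* G. Kozma, S. Nitzan, arXiv:2401.12397 (2024), §4 pp. 27–31 ((30), (32), (33), (36), (37)). [KozmaNitzan2024]
* G. Grimmett, *The Random-Cluster Model*, Springer 2006: Thm. (3.7) p. 39; Thm. (3.21), eq. (3.22). [Grimmett2006]
* Cell documents: REFUTER-REPORT §8 F4 (prim-bschramm-fkp-18r); transplant/BINDER-OWNERS.md row 7;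
  transplant/prim-bschramm-fkt-p4/FT06-DESIGN.md.
-/

noncomputable section

open MeasureTheory Finset
open scoped ENNReal Classical

namespace Summit.CriticalPhenomena.PercolationContinuityZ3.Theorems.FK

open Literature.Probability.Percolation Literature.Probability.LatticeModels
open Literature.Probability.Percolation.KozmaNitzan Literature.Probability.Percolation.GadgetSystem
open Transplant

variable {d : ℕ}

open KSch Cells

variable (S : KSch d) (q : ℝ)

/-- **The event `B_j` (FK)** (KN p. 30): the conditional probability (30)-FK at level `j` — under the minimal
law of the direction, pinned on the observation — of reaching `F^{j+1}_{v,x}` is `≤ 1 - δ₂`. Twin of tree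
`KSch.Bev`. [cite: KozmaNitzan2024, §4 p. 30 (B_j)] -/
def BevFK (h : ProbeHistory (Site d)) (e : Site 2 × MDir) (du : MDir) (j : ℕ) (δ₂ : ℝ) : Set (BondConfig (Site d)) :=
  {ω | (fkLaw (S.Sx h e du) (S.Wt h e du j (obs ω (S.env h e))) q).real
      (⋃ b ∈ S.C.Face (tgt e) du (j + 1), openConn (0 : Site d) b) ≤ 1 - δ₂}

/-- **The geometric twin**: KN's scheme with the same cells and parameter and the VACUOUS threshold `δ = 2`. Its
`KSch.Valid` ((29), (31), explored-edge bookkeeping, and the trivially true `1 - 2 < P(·)`) is the geometric part of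
`ValidFK`, and its regions / conditioned edges / weightings / events are those of `S` (they depend on the cells
only), so every law-free lemma of `KozmaNitzanSteps.lean` applies to `ValidFK` histories through it. [folklore] -/
def geomTwin : KSch d := ⟨S.C, S.p, 2⟩

variable {S q}

/-- An FK-valid history is geometrically valid (the twin's `KSch.Valid`). [folklore] -/
theorem geomTwin_valid_of_validFK {h : ProbeHistory (Site d)} {e : Site 2 × MDir} (hV : ValidFK S q h e) :
    (geomTwin S).Valid h e where
  F_eq := hV.F_eq
  ξ_sub := hV.ξ_sub
  zero_mem := hV.zero_mem
  src_mem := hV.src_mem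
  cover := hV.cover
  reach := lt_of_lt_of_le (by norm_num [geomTwin]) measureReal_nonneg


/-- `condL` only depends on the observation on the new conditioned edges. [folklore] -/
theorem condFK_congr (h : ProbeHistory (Site d)) (e : Site 2 × MDir) (du : MDir) (j : ℕ) {o o' : Finset (Sym2 (Site d))}
    (hoo' : ∀ x ∈ S.Fj h e du j \ S.F h, x ∈ o ↔ x ∈ o') : condFK S q h e du j o ↔ condFK S q h e du j o' := by
  unfold condFK KSch.Wt
  rw [S.pat_congr h e du j hoo']

/-- A bad direction is determined by the fresh conditioned lattice edges of level `K - 1`. [folklore] -/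
theorem determinedBy_badFK (h : ProbeHistory (Site d)) (e : Site 2 × MDir) (du : MDir) :
    DeterminedBy (badFK S q h e du) (↑(S.Fj h e du (S.C.K - 1) \ S.F h) : Set (Sym2 (Site d))) := by
  rw [determinedBy_iff]
  intro ω ω' hωω'
  simp only [badFK, Set.mem_setOf_eq]
  refine forall₂_congr fun j hj => not_congr (condFK_congr h e du j fun x hx => ?_)
  have hx' : x ∈ S.Fj h e du (S.C.K - 1) \ S.F h :=
    Finset.mem_sdiff.2 ⟨S.Fj_mono h e du (by omega) (Finset.mem_sdiff.1 hx).1, (Finset.mem_sdiff.1 hx).2⟩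
  simp only [mem_obs_iff]
  refine and_congr_right fun _ => ⟨fun h1 => ?_, fun h1 => ?_⟩
  · exact ((Set.ext_iff.1 hωω' x).1 ⟨h1, Finset.mem_coe.2 hx'⟩).1
  · exact ((Set.ext_iff.1 hωω' x).2 ⟨h1, Finset.mem_coe.2 hx'⟩).1

/-- `B_j` is determined by the conditioned lattice edges of level `j`. [folklore] -/
theorem determinedBy_BevFK (h : ProbeHistory (Site d)) (e : Site 2 × MDir) (du : MDir) (j : ℕ) (δ₂ : ℝ) :
    DeterminedBy (BevFK S q h e du j δ₂) (↑(S.Fj h e du j) : Set (Sym2 (Site d))) := by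
  rw [determinedBy_iff]
  intro ω ω' hωω'
  have key : S.pat h e du j (obs ω (S.env h e)) = S.pat h e du j (obs ω' (S.env h e)) := by
    refine S.pat_congr h e du j fun x hx => ?_
    have hxF : x ∈ S.Fj h e du j := (Finset.mem_sdiff.1 hx).1
    simp only [mem_obs_iff]
    refine and_congr_right fun _ => ⟨fun h1 => ?_, fun h1 => ?_⟩
    · exact ((Set.ext_iff.1 hωω' x).1 ⟨h1, Finset.mem_coe.2 hxF⟩).1
    · exact ((Set.ext_iff.1 hωω' x).2 ⟨h1, Finset.mem_coe.2 hxF⟩).1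
  simp only [BevFK, Set.mem_setOf_eq, KSch.Wt, key]

/-- The pinned pattern is monotone in the observation. [folklore] -/
theorem pat_mono (h : ProbeHistory (Site d)) (e : Site 2 × MDir) (du : MDir) (j : ℕ) {o o' : Finset (Sym2 (Site d))}
    (hoo' : o ⊆ o') : S.pat h e du j o ⊆ S.pat h e du j o' := by
  unfold KSch.pat
  exact Finset.union_subset_union le_rfl (Finset.inter_subset_inter hoo' le_rfl)

/-- The weighting of (30) is pointwise monotone in the observation. [folklore] -/
theorem Wt_mono (h : ProbeHistory (Site d)) (e : Site 2 × MDir) (du : MDir) (j : ℕ) {o o' : Finset (Sym2 (Site d))}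
    (hoo' : o ⊆ o') (x : Sym2 (Site d)) : S.Wt h e du j o x ≤ S.Wt h e du j o' x := by
  unfold KSch.Wt
  have hpat : (↑(S.pat h e du j o) : Set (Sym2 (Site d))) ∩ ↑(S.Fj h e du j) ⊆ ↑(S.pat h e du j o') :=
    fun y hy => Finset.mem_coe.2 (pat_mono h e du j hoo' (Finset.mem_coe.1 hy.1))
  by_cases hx : x ∈ wireSet (↑(S.Sx h e du) : Set (Site d))
  · rw [restrW_apply_of_mem _ hx, restrW_apply_of_mem _ hx]
    by_cases hxF : x ∈ (↑(S.Fj h e du j) : Set (Sym2 (Site d)))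
    · by_cases hxo : x ∈ (↑(S.pat h e du j o) : Set (Sym2 (Site d)))
      · rw [pinW_apply_of_mem_of_mem _ hxF hxo, pinW_apply_of_mem_of_mem _ hxF (hpat ⟨hxo, hxF⟩)]
      · rw [pinW_apply_of_mem_of_not_mem _ hxF hxo]; exact bot_le
    · rw [pinW_apply_of_not_mem _ _ hxF, pinW_apply_of_not_mem _ _ hxF]
  · rw [restrW_apply_of_not_mem _ hx]; exact bot_le

section WithLaw

variable {D : Set (Sym2 (Site d))} {h : ProbeHistory (Site d)} {e : Site 2 × MDir} {du : MDir}
  (hL : IsPinningLaw (fun W => fkLaw (S.Sx h e du) W q) D)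
include hL

/-- **Goodness is monotone in the observation** ((M): more observed-open edges raise the pinned law on the
increasing event `{0 ↔ M_x}`). [cite: KozmaNitzan2024, §4 p. 27 ((30)); Grimmett2006, Thm. (3.21), eq. (3.22)] -/
theorem condFK_mono (j : ℕ) {o o' : Finset (Sym2 (Site d))}
    (hoo' : o ⊆ o') (hc : condFK S q h e du j o) : condFK S q h e du j o' := by
  unfold condFK at hc ⊢
  refine lt_of_lt_of_le hc (hL.mono _ _ (fun x _ => Wt_mono h e du j hoo' x) _ ?_ ?_)
  · exact isUpperSet_biUnion_openConn _ _
  · exact measurableSet_biUnion_openConn _ _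

/-- **A bad direction is a decreasing event** (REFUTER-REPORT F4 (b)). [cite: KozmaNitzan2024, §4 p. 31] -/
theorem isLowerSet_badFK : IsLowerSet (badFK S q h e du) := by
  intro ω ω' hle hω j hj hc
  refine hω j hj (condFK_mono hL j (fun x hx => ?_) hc)
  rw [mem_obs_iff] at hx ⊢
  exact ⟨hx.1, hle hx.2⟩

end WithLaw

/-! ## One examination: the setting -/

section Examination

variable {D : Set (Sym2 (Site d))}
variable {h : ProbeHistory (Site d)} {e : Site 2 × MDir} (hV : ValidFK S q h e) {du : MDir}
  (hdu : du ∈ S.onward h (tgt e))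

include hV hdu

/-- Under the law of `Wfull`, almost surely the pattern on the explored edges is the recorded one and every open pair
inside `Sx` is a lattice edge (weights `1`/`0` on the explored edges, `0` on non-lattice pairs).
[cite: KozmaNitzan2024, §4 p. 28 (Ω)] -/
theorem real_compl_asSet_eq_zero (hL : IsPinningLaw (fun W => fkLaw (S.Sx h e du) W q) D) (hD : (↑(pairsF (S.Sx h e du)) : Set (Sym2 (Site d))) ⊆ D) :
    (fkLaw (S.Sx h e du) (S.Wfull h e du) q).real
      (localCylinder (↑(S.F h) : Set (Sym2 (Site d))) ↑(S.ξ h) ∩ lattOnly (S.Sx h e du))ᶜ = 0 := by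
  haveI := hL.prob (S.Wfull h e du)
  have hdu' : du ∈ (geomTwin S).onward h (tgt e) := hdu
  have hV' : (geomTwin S).Valid h e := geomTwin_valid_of_validFK hV
  have hFw : (↑(S.F h) : Set (Sym2 (Site d))) ⊆ wireSet (↑(S.Sx h e du) : Set (Site d)) :=
    KSch.Valid.coe_F_subset_wireSet (S := (geomTwin S)) hV' (du := du)
  have hFD : (↑(S.F h) : Set (Sym2 (Site d))) ⊆ D := fun x hx => hD (by rw [coe_pairsF]; exact hFw hx)
  -- the cylinder of the record
  have h1 : (fkLaw (S.Sx h e du) (S.Wfull h e du) q).real (localCylinder (↑(S.F h) : Set (Sym2 (Site d))) ↑(S.ξ h))ᶜ = 0 := by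
    refine hL.null _ _ _ hFD (S.F h).finite_toSet.countable (fun x hx hxξ => ?_) (fun x hx hxξ => ?_)
    · unfold KSch.Wfull; rw [restrW_apply_of_mem _ (hFw hx), pinW_apply_of_mem_of_mem _ hx hxξ]
    · unfold KSch.Wfull; rw [restrW_apply_of_mem _ (hFw hx), pinW_apply_of_mem_of_not_mem _ hx hxξ]
  -- the non-lattice pairs inside `Sx`
  set K : Set (Sym2 (Site d)) := {x | x ∈ (↑(pairsF (S.Sx h e du)) : Set (Sym2 (Site d))) ∧ x ∉ (zdGraph d).edgeSet}
    with hK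
  have h2 : (fkLaw (S.Sx h e du) (S.Wfull h e du) q).real (localCylinder K ∅)ᶜ = 0 := by
    refine hL.null _ K ∅ (fun x hx => hD hx.1) ((pairsF (S.Sx h e du)).finite_toSet.countable.mono fun x hx => hx.1)
      (fun x _ hx => (Set.notMem_empty x hx).elim) (fun x hx _ => ?_)
    have hxS : x ∈ wireSet (↑(S.Sx h e du) : Set (Site d)) := by rw [← coe_pairsF]; exact hx.1
    have hxF : x ∉ (↑(S.F h) : Set (Sym2 (Site d))) := fun hxF =>
      hx.2 (KSch.Valid.mem_edgeSet_of_mem_F (S := (geomTwin S)) hV' (Finset.mem_coe.1 hxF))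
    unfold KSch.Wfull
    rw [restrW_apply_of_mem _ hxS, pinW_apply_of_not_mem _ _ hxF, lattW_apply, if_neg hx.2]
  have hsub : (localCylinder (↑(S.F h) : Set (Sym2 (Site d))) ↑(S.ξ h) ∩ lattOnly (S.Sx h e du))ᶜ ⊆
      (localCylinder (↑(S.F h) : Set (Sym2 (Site d))) ↑(S.ξ h))ᶜ ∪ (localCylinder K ∅)ᶜ := by
    intro ω hω
    rw [Set.mem_compl_iff, Set.mem_inter_iff, not_and_or] at hω
    rcases hω with hω | hω
    · exact Or.inl hω
    · right
      intro hωK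
      apply hω
      intro x hx hxω
      by_contra hxE
      exact ((hωK x ⟨Finset.mem_coe.2 hx, hxE⟩).1 hxω).elim
  exact le_antisymm ((measureReal_mono hsub (measure_ne_top _ _)).trans
    ((measureReal_union_le _ _).trans (by rw [h1, h2, add_zero]))) measureReal_nonneg

/-! ## Step IV, first claim under the law: `M_x` is reached through the corridor (Lemma 12) -/

/-- **Step IV, first claim under a pinning law** (KN p. 30–31): if (32) holds under the law of `W₀` and Lemma 12
holds under the law (hypothesis `hcorr`, FT-04's `KNFreeCorridorBound` shape), then
`μ_{Wfull}(0 ↔ M_x in E_i ∪ E_{w,v} ∪ H_{v,x}) > 1 - ε'`. At `q = 1` the passage from `W₀` to `Wfull` was an equality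
(product structure); here it is the monotonicity (M) on an increasing event. [cite: KozmaNitzan2024, §4 pp. 30–31 (Step IV)] -/
theorem reach_boundFK (hL : IsPinningLaw (fun W => fkLaw (S.Sx h e du) W q) D) {ε' : ℝ}
    (hreach0 : 1 - S.δc < (fkLaw (S.Sx h e du) (S.W₀ h e) q).real (⋃ t ∈ S.C.M (tgt e), openConn (0 : Site d) t))
    (hcorr : FKCorridorAt d q S.p S.δc ε' S.C.r) :
    1 - ε' < (fkLaw (S.Sx h e du) (S.Wfull h e du) q).real (S.Reach h e du) := by
  have hdu' : du ∈ (geomTwin S).onward h (tgt e) := hdu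
  have hV' : (geomTwin S).Valid h e := geomTwin_valid_of_validFK hV
  set T := cdOf S h e du with hT
  have hA : T.Aset = S.V h ∪ S.C.Ewv e.1 e.2 := KSch.Valid.cd_Aset (S := (geomTwin S)) hV' hdu'
  set A : Finset (Site d) := S.V h ∪ S.C.Ewv e.1 e.2 with hAdef
  have h0A : (0 : Site d) ∈ (↑A : Set (Site d)) := Finset.mem_coe.2 (Finset.mem_union_left _ hV.zero_mem)
  have hAS : A ⊆ S.Sx h e du := Finset.subset_union_left
  haveI := hL.prob (S.W₀ h e)
  -- Step 1: under the law of `W₀`, `{0 ↔ M_v}` is `{0 ↔ M_v in A}` almost surely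
  set N : Set (BondConfig (Site d)) := {ω | ω ⊆ D} ∩ localCylinder (D \ wireSet (↑A : Set (Site d))) ∅ with hN
  have hN0 : (fkLaw (S.Sx h e du) (S.W₀ h e) q).real Nᶜ = 0 := by
    have h1 := hL.subset (S.W₀ h e)
    have h2 : (fkLaw (S.Sx h e du) (S.W₀ h e) q).real (localCylinder (D \ wireSet (↑A : Set (Site d))) ∅)ᶜ = 0 := by
      refine hL.null _ _ ∅ Set.sdiff_subset (Set.to_countable _) (fun x _ hx => (Set.notMem_empty x hx).elim)
        (fun x hx _ => ?_)
      unfold KSch.W₀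
      exact restrW_apply_of_not_mem _ hx.2
    rw [hN, Set.compl_inter]
    exact le_antisymm ((measureReal_union_le _ _).trans (by rw [h1, h2, add_zero])) measureReal_nonneg
  have hstep1 : (fkLaw (S.Sx h e du) (S.W₀ h e) q).real (⋃ t ∈ S.C.M (tgt e), openConn (0 : Site d) t) ≤
      (fkLaw (S.Sx h e du) (S.W₀ h e) q).real (⋃ t ∈ (↑(S.C.M (tgt e)) : Set (Site d)), openConnIn (↑A : Set (Site d)) 0 t) := by
    have hsub : (⋃ t ∈ S.C.M (tgt e), openConn (0 : Site d) t) ⊆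
        (⋃ t ∈ (↑(S.C.M (tgt e)) : Set (Site d)), openConnIn (↑A : Set (Site d)) 0 t) ∪ Nᶜ := by
      intro ω hω
      by_cases hωN : ω ∈ N
      · left
        simp only [Set.mem_iUnion, exists_prop, Finset.mem_coe] at hω ⊢
        obtain ⟨t, ht, hωt⟩ := hω
        refine ⟨t, ht, ?_⟩
        rw [DCT16.mem_openConnIn_iff_pathIn]
        have hω' : ∀ x ∈ ω, x ∈ wireSet (↑A : Set (Site d)) := fun x hx => by
          by_contra hxA
          exact ((hωN.2 x ⟨hωN.1 hx, hxA⟩).1 hx).elim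
        exact pathIn_of_reachable_of_forall_mem_wireSet hω' h0A hωt
      · exact Or.inr hωN
    exact (measureReal_mono hsub (measure_ne_top _ _)).trans
      ((measureReal_union_le _ _).trans (by rw [hN0, add_zero]))
  -- Step 2: (M) from `W₀` to `Wfull` (same pinning, larger region)
  have hstep2 : (fkLaw (S.Sx h e du) (S.W₀ h e) q).real (⋃ t ∈ (↑(S.C.M (tgt e)) : Set (Site d)), openConnIn (↑A : Set (Site d)) 0 t) ≤
      (fkLaw (S.Sx h e du) (S.Wfull h e du) q).real (⋃ t ∈ (↑(S.C.M (tgt e)) : Set (Site d)), openConnIn (↑A : Set (Site d)) 0 t) := by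
    refine hL.mono _ _ (fun x _ => ?_) _ (isUpperSet_biUnion_openConnIn _ _ _) (measurableSet_biUnion_openConnIn _ _ _)
    unfold KSch.W₀ KSch.Wfull
    by_cases hx : x ∈ wireSet (↑(S.V h ∪ S.C.Ewv e.1 e.2) : Set (Site d))
    · rw [restrW_apply_of_mem _ hx, restrW_apply_of_mem _ (KozmaNitzan.wireSet_mono (Finset.coe_subset.2 hAS) hx)]
    · rw [restrW_apply_of_not_mem _ hx]; exact bot_le
  -- Step 3: Lemma 12
  have hyp : 1 - S.δc < (fkLaw (S.Sx h e du) T.W q).real (⋃ b ∈ Finset.Icc (T.c - ((3 * T.r : ℕ) : Site d))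
      (T.c + ((3 * T.r : ℕ) : Site d)), openConnIn (↑T.Aset : Set (Site d)) T.o b) := by
    rw [hA, ← Finset.set_biUnion_coe]
    exact lt_of_lt_of_le hreach0 (hstep1.trans hstep2)
  have concl := hcorr T (KSch.Valid.cd_hyp (S := (geomTwin S)) hV' hdu') le_rfl hyp
  have hU : (↑T.Uset : Set (Site d)) = ↑(S.V h ∪ S.C.Ewv e.1 e.2 ∪ S.C.Hfull (tgt e) du) := by
    change (↑(T.Aset ∪ S.C.Hfull (tgt e) du) : Set (Site d)) = _
    rw [hA]
  have hTn : T.Tn (3 * T.r) = S.C.M (tgt e + stepVec du) := by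
    change Finset.Icc (T.cnext - ((3 * S.C.r : ℕ) : Site d)) (T.cnext + ((3 * S.C.r : ℕ) : Site d)) = _
    rw [KSch.cd_cnext]; rfl
  rw [hTn, hU, ← Finset.set_biUnion_coe] at concl
  exact concl

end Examination

end Summit.CriticalPhenomena.PercolationContinuityZ3.Theorems.FK

end
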